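import Mathlib.Algebra.BigOperators.Ring.Finset
import Mathlib.Algebra.BigOperators.Group.Finset.Sigma
import Mathlib.Logic.Function.Iterate
import Mathlib.Data.Fintype.Fin
import HarnessLib

/-!
# Abel summation on a rooted tree (the scale-telescoping identities of power counting)

Topic `Literature/Probability/LatticeModels`.  In the dimensional bounds of the tree expansion one
converts factors indexed by the vertices `v` of a Gallavotti–Nicolò tree and the *absolute* scale
`h_v - h` into factors indexed by the *scale jumps* `h_v - h_{v'}` along the lines (`v'` the vertex
preceding `v`), e.g. (Mastropietro 2008, (3.22)–(3.23))

`Σ_v (h_v - h)(s_v - 1) = Σ_v (h_v - h_{v'})(m_{4,v} - 1)`,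
`Σ_v (h_v - h) n⁰_v = Σ_v (h_v - h_{v'})(2 m_{4,v} - n^e_v/2)`,

where `m_{4,v}`, the number of endpoints following `v`, is the *subtree sum* of the indicator of the
endpoints.  Both are instances of **Abel summation on a rooted tree**: for vertex weights `m_u` and
labels `h_u`, with `M_v = Σ_{u ≥ v} m_u` the subtree sums,

`Σ_{v ≠ root} (h_v - h_{v'}) M_v = Σ_u (h_u - h_root) m_u`   (`sum_sub_parent_mul_subtreeSum`),

proved here for a rooted tree on `Fin (k + 1)` given by a parent map `p` with `p 0 = 0` (the root) and
`p j < j`.  Everything is proved; no named fact. [folklore]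

## Sources

V. Mastropietro, *Non-Perturbative Renormalization* (2008), §3.2 (3.22)–(3.25), PDF p. 55 of the
held copy (`Mastropietro2008`); G. Benfatto, A. Giuliani, V. Mastropietro, Ann. Henri Poincaré 7
(2006), §2.5–2.6 (the dimensional bound (2.77)) (`BenfattoGiulianiMastropietro2006`).
-/

noncomputable section

open Finset Function

namespace Literature.Probability.LatticeModels

namespace RootedTree

variable {k : ℕ} (p : Fin (k + 1) → Fin (k + 1))

/-- `v` lies on the path from the root to `u` (or `v = u`): `v` is an iterated parent of `u`.
[folklore] -/
def IsAnc (v u : Fin (k + 1)) : Prop := ∃ t : ℕ, p^[t] u = v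

/-- The vertices of the path from `u` up to, but excluding, the root. [folklore] -/
def pathSet (u : Fin (k + 1)) : Finset (Fin (k + 1)) := by
  classical exact univ.filter fun v => v ≠ 0 ∧ IsAnc p v u

/-- The **subtree sum** `M_v = Σ_{u ≥ v} m_u` of vertex weights over the vertices following `v`.
[folklore] -/
def subtreeSum {R : Type*} [AddCommMonoid R] (m : Fin (k + 1) → R) (v : Fin (k + 1)) : R := by
  classical exact ∑ u ∈ univ.filter (fun u => IsAnc p v u), m u

variable {p} (hp0 : p 0 = 0) (hp : ∀ j, j ≠ 0 → p j < j)
include hp0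

/-- The root is its only ancestor. [folklore] -/
theorem isAnc_zero_iff {v : Fin (k + 1)} : IsAnc p v 0 ↔ v = 0 := by
  constructor
  · rintro ⟨t, rfl⟩
    induction t with
    | zero => rfl
    | succ t ih => rw [iterate_succ_apply, hp0, ih]
  · rintro rfl; exact ⟨0, rfl⟩

omit hp0 in
/-- Path decomposition: the non-root ancestors of `u ≠ 0` are `u` and the non-root ancestors of its
parent. [folklore] -/
theorem isAnc_iff_of_ne_zero {v u : Fin (k + 1)} : IsAnc p v u ↔ v = u ∨ IsAnc p v (p u) := by
  constructor
  · rintro ⟨t, rfl⟩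
    cases t with
    | zero => exact Or.inl rfl
    | succ t => exact Or.inr ⟨t, by rw [iterate_succ_apply]⟩
  · rintro (rfl | ⟨t, rfl⟩)
    · exact ⟨0, rfl⟩
    · exact ⟨t + 1, by rw [iterate_succ_apply]⟩

include hp

/-- An ancestor has a smaller index. [folklore] -/
theorem le_of_isAnc {v u : Fin (k + 1)} (h : IsAnc p v u) : v ≤ u := by
  obtain ⟨t, rfl⟩ := h
  induction t generalizing u with
  | zero => exact le_rfl
  | succ t ih =>
    rw [iterate_succ_apply]
    by_cases hu : u = 0
    · rw [hu, hp0]; exact (ih (u := 0)).trans le_rfl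
    · exact (ih (u := p u)).trans (hp u hu).le

/-- **Telescoping along the path to the root**: `Σ_{v ∈ path(u)} (h_v - h_{p v}) = h_u - h_root`.
[folklore] -/
theorem sum_pathSet_sub {R : Type*} [AddCommGroup R] (h : Fin (k + 1) → R) (u : Fin (k + 1)) :
    ∑ v ∈ pathSet p u, (h v - h (p v)) = h u - h 0 := by
  classical
  induction u using Fin.strong_induction_on with
  | _ u ih =>
    by_cases hu : u = 0
    · subst hu
      have hempty : pathSet p (0 : Fin (k + 1)) = ∅ := by
        ext v
        simp only [pathSet, mem_filter, mem_univ, true_and, notMem_empty, iff_false, not_and]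
        intro hv hanc
        exact hv ((isAnc_zero_iff hp0).1 hanc)
      rw [hempty, sum_empty, sub_self]
    · have hsplit : pathSet p u = insert u (pathSet p (p u)) := by
        ext v
        simp only [pathSet, mem_filter, mem_univ, true_and, mem_insert]
        rw [isAnc_iff_of_ne_zero (p := p)]
        constructor
        · rintro ⟨hv, rfl | h'⟩
          · exact Or.inl rfl
          · exact Or.inr ⟨hv, h'⟩
        · rintro (rfl | ⟨hv, h'⟩)
          · exact ⟨hu, Or.inl rfl⟩
          · exact ⟨hv, Or.inr h'⟩
      have hnot : u ∉ pathSet p (p u) := by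
        intro hmem
        have hle := le_of_isAnc hp0 hp ((mem_filter.1 hmem).2.2)
        exact absurd (hp u hu) (not_lt.2 hle)
      rw [hsplit, sum_insert hnot, ih (p u) (hp u hu), sub_add_sub_cancel]

/-- **Abel summation on a rooted tree** (Mastropietro 2008, (3.22)–(3.23)): with the subtree sums
`M_v = Σ_{u ≥ v} m_u`, `Σ_{v ≠ root} (h_v - h_{v'}) M_v = Σ_u (h_u - h_root) m_u`. [cite: Mastropietro2008, §3.2 (3.22)-(3.23)] -/
theorem sum_sub_parent_mul_subtreeSum {R : Type*} [CommRing R] (h m : Fin (k + 1) → R) :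
    ∑ v ∈ univ.filter (fun v : Fin (k + 1) => v ≠ 0), (h v - h (p v)) * subtreeSum p m v =
      ∑ u, (h u - h 0) * m u := by
  classical
  calc ∑ v ∈ univ.filter (fun v : Fin (k + 1) => v ≠ 0), (h v - h (p v)) * subtreeSum p m v
      = ∑ v ∈ univ.filter (fun v : Fin (k + 1) => v ≠ 0), ∑ u, if IsAnc p v u then (h v - h (p v)) * m u else 0 := by
        refine sum_congr rfl fun v _ => ?_
        rw [subtreeSum, mul_sum, sum_filter]
    _ = ∑ u, ∑ v ∈ univ.filter (fun v : Fin (k + 1) => v ≠ 0), if IsAnc p v u then (h v - h (p v)) * m u else 0 :=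
        Finset.sum_comm
    _ = ∑ u, (∑ v ∈ pathSet p u, (h v - h (p v))) * m u := by
        refine sum_congr rfl fun u _ => ?_
        rw [sum_mul, pathSet, sum_filter, sum_filter]
        refine sum_congr rfl fun v _ => ?_
        by_cases hv : v ≠ 0 <;> by_cases ha : IsAnc p v u <;> simp [hv, ha]
    _ = ∑ u, (h u - h 0) * m u := sum_congr rfl fun u _ => by rw [sum_pathSet_sub hp0 hp h u]

end RootedTree

end Literature.Probability.LatticeModels
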